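import Summits.Langlands.Langlands.Theorems.SqrtFiveQuarticCoversCertB3H8CoordsKernel
import HarnessLib

/-!
# Route `Langlands/SqrtFiveQuarticCovers`, certificate `CertB3H8` (sheets 4.2 + 4.6;
# stmt-Langlands-23413) from NF-K1 and CERT-E6 in COORDINATE form — row `hE6` «E6-COORDS (α′)» of
# the cell's NAMED-INPUT TABLE

Companion of `Theorems/SqrtFiveQuarticCoversCertB3H8.lean` (typ-1; `certB3H8_of_facts (hE6) (hB)`)
and `Theorems/SqrtFiveQuarticCoversCertB3H8CoordsKernel.lean` (this seat: the kernel replay).  In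
`certB3H8_of_facts` the certified computation CERT-E6 enters at `j`-LEVEL and MERGED with the model
identification: `hE6` «`b3 ∧ H8` framings over a totally real quartic `K ∋ √5` ⇒ `c₄ = 0 ∨
m_B(j) = 0`» (ref-2 AUDIT f0c4090a34bbca7d, label L2: "NF-K1 is a named input INSIDE hE6").  Here
the two are SEPARATED and the computation is re-typed in the COORDINATE form both lineages literally
output (the (α) pattern of `Theorems/SqrtFiveQuarticCoversCertS3H8Coords.lean`, p672826):

* `hK1` (kind MODEL, named, not proved): framings ⇒ a `K`-point of the explicit genus-`5` model
  `𝒳_r` of `X(b3,H8)_k = X₀(75)^ε` over FLS's PRINTED quartic of `C = X(b3,s5)`, at which the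
  typed `j`-map `F/G` of `C` (Literature `FLS2015.b3s5JNum/JDen`, p675611) takes the value `j(E)`;
* `hE6c` (kind CFC): every `K`-point of `𝒳_r` (`K` totally real quartic `∋ r`) projects to one of
  `6 + 3` printed points of `C(k)` or to an orbit-B point `P(t)` — no `j` in it;
* kernel (`c4_eq_zero_or_mB_of_b3s5_listedPoint`): coordinates ⇒ `c₄ = 0 ∨ m_B = 0`.

So `certB3H8_of_modelIdentification_of_coords hK1 hE6c hB : CertB3H8` (by name), through
`certB3H8_of_facts`.  For Record v2 (typ-3 lineage): binder `hE6` ↦ (`hK1B3H8` MODEL + `hE6c` CFC)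
— one binder more, the CFC binder lighter (a point list), the `j`-step in the kernel; the print part
of `hK1` (moduli of `X(b3,s5)` + quartic + `j = F/G`) is ALSO available as the Literature named fact
`FLS2015.b3s5_jRelation_of_isTorsionGaloisRep` (p675611), which `hK1` refines by the cell's lift
(the `H8`-structure); the two cannot be split into separate hypotheses because `C` has several points
over `j(E)` of which only the `H8`-compatible ones lift (group theory: for image exactly `H8` three
pairs of lines are `H8`-stable, one pair gives `H8 ∩ C_s = C₄`, the others `V₄`).

HONEST STATUS: CONDITIONAL bookkeeping + kernel algebra; `certB3H8_of_modelIdentification_of_coords`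
holds modulo {`hK1` (MODEL: FLS §2.2 moduli + §5.2 quartic + `j = F/G` print/ancillary; CELL:
ref-1's `X₀(75)` model, twist `ε`, matrix `M` — validated by point counts incl. the
twist-discriminating `p = 59`, never proved), `hE6c` (CFC: ref-1 E6′ + stage J ∥ eng-1 e6p ∥ ref-1
E6 genus-`5` sieve; certnum RELEASES l.124/128/130/135–139, RQ-026 CLOSED; resting on rank `0` of
`15a, 75b, 75c` over `k` — PRINTED FLS §5.2 + KL/Kato from l.123 — Katz injectivity, `J_C(k) = H`),
`hB` (CERT-E11(B), as in `certB3H8_of_facts`)}; nothing here proves modularity of any curve; «a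
certified finite datum is not a modularity statement».  References: [FreitasLeHungSiksek2015] §2.2
(p. 9), §5.2 (pp. 24–25) of arXiv:1310.7088; cell records CENSUS.md §15 rows 4.2/4.6,
NAMED-INPUT-TABLE.md v1.4 row 1, ref-2 TABLE-READ-v1.3.md c05b4ca8c3af004c row 1, ref-1
`E6/E6-PREP.md` 8b99305451eee2f7, `E6p/E6P-TABLE.md` b7244e5a42961ffe, stage J j313785.
-/

noncomputable section

set_option linter.dupNamespace false -- project-wide option; `Summit.Langlands.Langlands` is the mandated namespace

open scoped MatrixGroups NumberField Matrix
open NumberField Field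
open Literature.NumberTheory.Automorphic Literature.NumberTheory.GaloisRepresentations
open Literature.NumberTheory.Automorphic.FLS2015
open Summit.Langlands.Langlands.Theses.SqrtFiveQuarticCovers

namespace Summit.Langlands.Langlands.Theorems.SqrtFiveQuarticCovers

/-! ### §4 `CertB3H8` from the model identification (coordinates) and CERT-E6 (coordinates) -/

/-- **`CertB3H8` (stmt-Langlands-23413, sheets 4.2 + 4.6) from NF-K1 in COORDINATES (`hK1`), the
certified computation CERT-E6 in COORDINATES (`hE6c`) and CERT-E11(B) (`hB`, verbatim from
`certB3H8_of_facts`)** — the (α′) refinement of `certB3H8_of_facts` (p670548, typ-1): its merged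
`j`-level input `hE6` «framings ⇒ c₄ = 0 ∨ m_B(j) = 0» is DERIVED here from
* `hK1` — **NF-K1-B3H8, MODEL IDENTIFICATION in coordinates** (named input, NOT proved in the
  tree; kind MODEL): for `K` a number field with `r ∈ K`, `r² = 5`, an `E / 𝓞 K` (`Δ ≠ 0`) with a
  Borel mod-`3` framing and an `H8` mod-`5` framing gives a `K`-point `(x:y:z:u:v)`,
  `(x,y,z) ≠ 0`, of the genus-`5` model `𝒳_r : Φ(x,y,z) = 0, 6u² = (5+r)A, 6uv = (5+r)B,
  6v² = (5+r)C` of `X(b3,H8)_k = X₀(75)^ε` over the PRINTED quartic `Φ` of `C = X(b3,s5)`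
  [FLS §5.2 p. 24], at which the `j`-map `F/G` of `C` [FLS §5.2 p. 24: `j = F/G`, `d = 15`;
  coefficients from the source's recipe, `Literature.…FLS2015.b3s5JNum/JDen`, p675611] takes the
  value `j(E)`: `c₄³·G = F·Δ`.  Print part = the Literature named fact
  `FLS2015.b3s5_jRelation_of_isTorsionGaloisRep` (b3 ∧ s5-normaliser ⇒ point of `C` with
  `c₄³G = FΔ`; `H8 ≤ C_s⁺(5)`, `closure_H8_le_normalizer_splitCartan`); CELL part = the lift: the
  model `X₀(75) ⊂ ℙ⁴` (three quadrics, ref-1 E6-PREP §1, point counts `p ≤ 17`), the twist `ε`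
  through `k(ζ₅) = k(√δ)`, `δ = −(5+√5)/2` (§2, END-TO-END point counts at `11,19,29,31,49`; eng-1
  twist validation incl. `p = 59`), the matrix `M` (stage J, j313785), and `A·C − B² = 36Φ`
  (`b3h8_liftQuadrics_rel`).  The two parts do NOT separate into two hypotheses: `C` has several
  points over `j(E)` and only the `H8`-structure says which one lifts (e.g. image exactly `H8`:
  three `C_s⁺(5)`-pairs of lines are stable, one lifts).  Both signs of `r` are covered because
  `diag(1,2)` normalises `H8` with non-square determinant (an `H8`-framing yields points on both
  `k`-components).
* `hE6c` — **CERT-E6 in COORDINATES** (certified finite computation; the LITERAL output of both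
  lineages): for `K` totally real quartic with `r ∈ K`, `r² = 5`, every `K`-point of `𝒳_r`
  projects to one of: the six cusps `P₀, P₁, P₃^{(σ)}, P₅^{(σ)}` of `C`, the three points
  `P₂, P₄^{(σ)}` (`j = 0`), or an orbit-B point `(t²+9t−13 : 18 : t²−9t−31)`, `t⁴ − 35t² + 205 = 0`
  — i.e. ref-1 E6′ (`E6P-TABLE.md` b7244e5a42961ffe: `C(k)` = the nine printed points, `67`
  quadratic points) + stage J (j313785: exactly the classes `deg2place#54`, `pt4+pt10` lift, both
  orbit B, `dd = (35 ± 9√5)/2`) = eng-1 `e6p` (lists IDENTICAL, referee DIFF 17:18:41Z) = ref-1 E6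
  genus-`5` `J(k)`-sieve on `X₀(75)^ε` (8 `k`-cusps + 9 quadratic points: 2 cuspidal over `ℚ(ζ₅)`,
  3 with `j = 0` over `P₂, P₄^{(σ)}`, 4 orbit B); certnum RELEASES l.124/128/130/135–139 (RQ-026
  CLOSED); resting on the named inputs listed in the `CertB3H8` module docstring (rank `0` of
  `15a, 75b, 75c` over `k`: FLS §5.2 PRINTED + KL/Kato from l.123; Katz; `J_C(k) = H`).  WEAKER
  than the census (no count, nothing on `u, v`), no `j` in it.
The passage «coordinates ⇒ `c₄ = 0 ∨ m_B = 0`» is `c4_eq_zero_or_mB_of_b3s5_listedPoint` (kernel: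
exact arithmetic in `ℚ(√5)` and `ℚ(t) = K₁`).  Conclusion = the route child `CertB3H8` BY NAME via
`certB3H8_of_facts`.  CONDITIONAL on the three inputs; nothing here proves modularity of any curve;
«a certified finite datum is not a modularity statement».
[cite: FreitasLeHungSiksek2015, §2.2 and §5.2 (arXiv:1310.7088 pp. 9, 24–25)] -/
theorem certB3H8_of_modelIdentification_of_coords
    (hK1 : ∀ (K : Type) [Field K] [NumberField K], ∀ r : K, r ^ 2 = 5 →
      ∀ E : WeierstrassCurve (NumberField.RingOfIntegers K), E.Δ ≠ 0 →
        (∃ ρ : Literature.NumberTheory.GaloisRepresentations.FramedGaloisRep K (ZMod 3) 2, (∃ e : (E.baseChange K).geomTorsion ((3 : ℕ) : ℤ) ≃+ (Fin 2 → ZMod 3), ∀ (σ : Field.absoluteGaloisGroup K) (P : (E.baseChange K).geomTorsion ((3 : ℕ) : ℤ)), e (σ • P) = ((ρ σ : GL (Fin 2) (ZMod 3)) : Matrix (Fin 2) (Fin 2) (ZMod 3)) *ᵥ (e P)) ∧ ((∀ σ : Field.absoluteGaloisGroup K, (((ρ σ : GL (Fin 2) (ZMod 3)) : Matrix (Fin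 2) (Fin 2) (ZMod 3)) 1 0 = 0)))) →
        (∃ ρ : Literature.NumberTheory.GaloisRepresentations.FramedGaloisRep K (ZMod 5) 2, (∃ e : (E.baseChange K).geomTorsion ((5 : ℕ) : ℤ) ≃+ (Fin 2 → ZMod 5), ∀ (σ : Field.absoluteGaloisGroup K) (P : (E.baseChange K).geomTorsion ((5 : ℕ) : ℤ)), e (σ • P) = ((ρ σ : GL (Fin 2) (ZMod 5)) : Matrix (Fin 2) (Fin 2) (ZMod 5)) *ᵥ (e P)) ∧ ((∀ σ : Field.absoluteGaloisGroup K, (ρ σ : GL (Fin 2) (ZMod 5)) ∈ Subgroup.closure ({(⟨!![2, 0; 0, 3], !![3, 0; 0, 2], by decide, by decide⟩ : GL (Fin 2) (ZMod 5)), (⟨!![0, 1; 1, 0], !![0, 1; 1, 0], by decide, by decide⟩ : GL (Fin 2) (ZMod 5))} : Set (GL (Fin 2) (ZMod 5)))))) →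
          ∃ x y z u v : K, (x ≠ 0 ∨ y ≠ 0 ∨ z ≠ 0) ∧ b3s5Quartic x y z = 0 ∧
            6 * u ^ 2 = (5 + r) * (-3 * x ^ 2 + 6 * x * y - 14 * x * z + 17 * y ^ 2 + 14 * y * z - 3 * z ^ 2) ∧
            6 * (u * v) = (5 + r) * (3 * x ^ 2 + 3 * x * y - 4 * x * z - 8 * y ^ 2 + 13 * y * z + 3 * z ^ 2) ∧
            6 * v ^ 2 = (5 + r) * (-3 * x ^ 2 - 12 * x * y - 14 * x * z + 8 * y ^ 2 - 4 * y * z - 3 * z ^ 2) ∧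
            (E.baseChange K).c₄ ^ 3 * b3s5JDen x y z = b3s5JNum x y z * (E.baseChange K).Δ)
    (hE6c : ∀ (K : Type) [Field K] [NumberField K], NumberField.IsTotallyReal K →
      Module.finrank ℚ K = 4 → ∀ r : K, r ^ 2 = 5 → ∀ x y z u v : K,
        (x ≠ 0 ∨ y ≠ 0 ∨ z ≠ 0) → b3s5Quartic x y z = 0 →
        6 * u ^ 2 = (5 + r) * (-3 * x ^ 2 + 6 * x * y - 14 * x * z + 17 * y ^ 2 + 14 * y * z - 3 * z ^ 2) →
        6 * (u * v) = (5 + r) * (3 * x ^ 2 + 3 * x * y - 4 * x * z - 8 * y ^ 2 + 13 * y * z + 3 * z ^ 2) →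
        6 * v ^ 2 = (5 + r) * (-3 * x ^ 2 - 12 * x * y - 14 * x * z + 8 * y ^ 2 - 4 * y * z - 3 * z ^ 2) →
      (x = 0 ∧ y = 0) ∨ (y = 0 ∧ z = 0) ∨ (y = -x ∧ z = 2 * x) ∨
      (x = -2 * z ∧ 2 * y = (-1 + r) * z) ∨ (x = -2 * z ∧ 2 * y = (-1 - r) * z) ∨
      (2 * x = (1 - r) * z ∧ y = (-3 + r) * z) ∨ (2 * x = (1 + r) * z ∧ y = (-3 - r) * z) ∨
      (2 * x = (1 + r) * z ∧ y = (2 + r) * z) ∨ (2 * x = (1 - r) * z ∧ y = (2 - r) * z) ∨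
      (∃ t : K, t ^ 4 - 35 * t ^ 2 + 205 = 0 ∧
        18 * x = (t ^ 2 + 9 * t - 13) * y ∧ 18 * z = (t ^ 2 - 9 * t - 31) * y))
    (hB : ∀ (K : Type) [Field K] [NumberField K], Module.finrank ℚ K = 4 →
      ∀ E : WeierstrassCurve (NumberField.RingOfIntegers K), E.Δ ≠ 0 →
        (E.baseChange K).c₄ ^ 12 - 736750 * (E.baseChange K).c₄ ^ 9 * (E.baseChange K).Δ
            - 107158989000 * (E.baseChange K).c₄ ^ 6 * (E.baseChange K).Δ ^ 2
            + 829200340371875 * (E.baseChange K).c₄ ^ 3 * (E.baseChange K).Δ ^ 3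
            - 601530697732559375 * (E.baseChange K).Δ ^ 4 = 0 →
        ∀ ρ : Literature.NumberTheory.GaloisRepresentations.FramedGaloisRep K (ZMod 7) 2,
          (∃ e : (E.baseChange K).geomTorsion ((7 : ℕ) : ℤ) ≃+ (Fin 2 → ZMod 7), ∀ (σ : Field.absoluteGaloisGroup K) (P : (E.baseChange K).geomTorsion ((7 : ℕ) : ℤ)), e (σ • P) = ((ρ σ : GL (Fin 2) (ZMod 7)) : Matrix (Fin 2) (Fin 2) (ZMod 7)) *ᵥ (e P)) →
          ∃ σ : Field.absoluteGaloisGroup K,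
            (Matrix.det ((ρ σ : GL (Fin 2) (ZMod 7)) : Matrix (Fin 2) (Fin 2) (ZMod 7)) = 3 ∨
              Matrix.det ((ρ σ : GL (Fin 2) (ZMod 7)) : Matrix (Fin 2) (Fin 2) (ZMod 7)) = 5 ∨
              Matrix.det ((ρ σ : GL (Fin 2) (ZMod 7)) : Matrix (Fin 2) (Fin 2) (ZMod 7)) = 6) ∧
            Matrix.trace ((ρ σ : GL (Fin 2) (ZMod 7)) : Matrix (Fin 2) (Fin 2) (ZMod 7)) ≠ 0 ∧
            ¬ IsSquare (Matrix.trace ((ρ σ : GL (Fin 2) (ZMod 7)) : Matrix (Fin 2) (Fin 2) (ZMod 7)) ^ 2 -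
              4 * Matrix.det ((ρ σ : GL (Fin 2) (ZMod 7)) : Matrix (Fin 2) (Fin 2) (ZMod 7)))) :
    CertB3H8 := by
  refine certB3H8_of_facts ?_ hB
  intro K _ _ hK hd hr5 E hΔ h3 h5
  obtain ⟨r, hr⟩ := hr5
  obtain ⟨x, y, z, u, v, hne, hΦ, hA, hBq, hC, hj⟩ := hK1 K r hr E hΔ h3 h5
  have hΔK : (E.baseChange K).Δ ≠ 0 := by
    rw [WeierstrassCurve.baseChange, WeierstrassCurve.map_Δ]
    exact (map_ne_zero_iff _ (FaithfulSMul.algebraMap_injective (𝓞 K) K)).2 hΔ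
  exact c4_eq_zero_or_mB_of_b3s5_listedPoint hr hΔK hne hj
    (hE6c K hK hd r hr x y z u v hne hΦ hA hBq hC)

end Summit.Langlands.Langlands.Theorems.SqrtFiveQuarticCovers

end
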